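import Summits.Ventures.HodgeRepro2.T5BergmanUnitary
import Summits.Ventures.HodgeRepro2.T5BergmanPairing
import Summits.Ventures.HodgeRepro2.T5BergmanCoefficientL2
import Summits.Ventures.HodgeRepro2.T5SU11Cartan

/-!
# The Bergman model IS Rühl's realisation `(k, +)` of the discrete series, as printed

Rühl, *The Lorentz group and harmonic analysis* (1970), §5-8 «Representations of the discrete series
as induced representations», realises the positive discrete series `(k, +)`, `k = 1/2, 1, 3/2, …`, on
holomorphic functions `Φ(w)` of the unit disc by

  `(5-96)  T_a Φ(w) = (-β̄ w + α)^{-2k} Φ(w_a)`,   `(5-88)  w_a = (ᾱ w - β) / (-β̄ w + α)`,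

with the scalar product `(5-94)/(5-97)` `(Φ₁, Φ₂) = (2k-1)/π ∫_{|w|<1} Φ̄₁ Φ₂ (1 - |w|²)^{2k-2} Dw`
(antilinear in the first variable; «From now on we use this normalization of (5-97) throughout»),
the orthonormal basis `(5-98)/(5-99)` `Φ_q(w) = N_q^k w^{q-k}`, `(N_q^k)² = C(k+q-1, q-k)`, `q = k, k+1, …`
(so `Φ_k = 1` with norm `1`), and the identities `(5-92)` `|-β̄ w + α|² = (1 - |w|²)/(1 - |w_a|²)`.

With `k_tree = 2 k_Rühl` (so the weight-`3` model `π₃⁺` is Rühl's `(3/2, +)`), the tree's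
`act k (su11 α β)` and `pairing k` of `T5BergmanCoefficient` are these formulas VERBATIM:
`act_toSU11` is `(5-96)` with `(5-88)`; `ruhlInner` below is `(5-94)/(5-97)` with its normalisation;
`ruhlInner_lowest_self` is `(5-99)` at `q = k`; `ruhlInner_act_act` is the unitarity of `(5-95)`;
`ruhlInner_monomial_eq_zero` is the orthogonality of `(5-98)`; `ruhl_5_92` is `(5-92)`; and the
lowest-weight matrix element is `(Φ_k, T_a Φ_k) = α^{-2k}`.  So the identification of the explicit
model with Rühl's `π₃⁺` is a comparison of printed formulas, not a printed input.

Blind lane: Mathlib + the HodgeRepro2 prefix only; no sorry; axioms ⊆ {propext, Classical.choice,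
Quot.sound}.
-/

namespace Summit.Ventures.HodgeRepro2.T5BergmanRuhlModel

open MeasureTheory Metric
open T5PoincareDensity T5PoincareInvariance T5PoincareMeasure T5SU11Unimodular T5SU11Fibration
  T5BergmanCoefficient T5BergmanUnitary T5BergmanPairing T5BergmanCoefficientL2 T5SU11Cartan
open scoped Real

/-! ### (5-96) with (5-88): the action, as printed -/

/-- The matrix of `(toSU11 α β)⁻¹` is `su11 ᾱ (-β)`. -/
lemma mat_toSU11_inv (α β : ℂ) (h : Complex.normSq α - Complex.normSq β = 1) :
    mat (toSU11 α β h)⁻¹ = su11 ((starRingEnd ℂ) α) (-β) := by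
  rw [mat_inv]
  rfl

/-- **Rühl (5-96) with (5-88), verbatim**: for `a = su11 α β` (`|α|² - |β|² = 1`),
`(T_a Φ)(w) = (-β̄ w + α)^{-2k_R} Φ((ᾱ w - β)/(-β̄ w + α))` — the tree's `act k` with `k = 2 k_R`. -/
theorem act_toSU11 (k : ℕ) (α β : ℂ) (h : Complex.normSq α - Complex.normSq β = 1)
    (Φ : ℂ → ℂ) (w : ℂ) :
    act k (toSU11 α β h) Φ w =
      (-(starRingEnd ℂ) β * w + α)⁻¹ ^ k *
        Φ (((starRingEnd ℂ) α * w - β) / (-(starRingEnd ℂ) β * w + α)) := by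
  unfold act
  rw [mat_toSU11_inv, denom_su11, mobius_su11]
  simp only [map_neg, Complex.conj_conj]
  congr 2

/-- **Rühl (5-92)**: `|-β̄ w + α|² = (1 - |w|²) / (1 - |w_a|²)` on the disc. -/
theorem ruhl_5_92 (α β : ℂ) (h : Complex.normSq α - Complex.normSq β = 1) {w : ℂ}
    (hw : w ∈ ball (0 : ℂ) 1) :
    Complex.normSq (-(starRingEnd ℂ) β * w + α) =
      (1 - Complex.normSq w) /
        (1 - Complex.normSq (((starRingEnd ℂ) α * w - β) / (-(starRingEnd ℂ) β * w + α))) := by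
  have hw' : Complex.normSq w < 1 := (mem_ball_iff_normSq w).mp hw
  have h' : Complex.normSq ((starRingEnd ℂ) α) - Complex.normSq (-β) = 1 := by
    rw [Complex.normSq_conj, Complex.normSq_neg]; exact h
  have key := one_sub_normSq_mobius h' hw'
  rw [mobius_su11] at key
  simp only [map_neg, Complex.conj_conj] at key
  have hden : (-(starRingEnd ℂ) β * w + α) ≠ 0 := by
    have := denom_ne_zero h' hw'
    simpa only [map_neg, Complex.conj_conj] using this
  have hN : Complex.normSq (-(starRingEnd ℂ) β * w + α) ≠ 0 := Complex.normSq_pos.mpr hden |>.ne'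
  have h1 : 0 < 1 - Complex.normSq w := by linarith
  rw [show (starRingEnd ℂ) α * w + -β = (starRingEnd ℂ) α * w - β by ring] at key
  rw [key]
  field_simp

/-! ### (5-94)/(5-97): the scalar product with Rühl's normalisation `(2k-1)/π` -/

/-- **Rühl's scalar product (5-94)/(5-97) with the normalisation `(2k_R - 1)/π = (k - 1)/π`**,
antilinear in the FIRST variable as printed: `(Φ₁, Φ₂) = (k-1)/π ∫_𝔻 Φ̄₁ Φ₂ (1 - |w|²)^{k-2} Dw`. -/
noncomputable def ruhlInner (k : ℕ) (Φ₁ Φ₂ : ℂ → ℂ) : ℂ :=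
  (((k : ℝ) - 1) / π : ℝ) * pairing k Φ₂ Φ₁

/-- `(Φ₁, Φ₂) = (k-1)/π ∫_𝔻 conj (Φ₁ w) Φ₂ w (1 - |w|²)^{k-2} dA` — the printed integral. -/
theorem ruhlInner_eq (k : ℕ) (Φ₁ Φ₂ : ℂ → ℂ) :
    ruhlInner k Φ₁ Φ₂ = (((k : ℝ) - 1) / π : ℝ) *
      ∫ w in ball (0 : ℂ) 1, (starRingEnd ℂ) (Φ₁ w) * Φ₂ w * (((1 - ‖w‖ ^ 2) ^ (k - 2) : ℝ) : ℂ) := by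
  unfold ruhlInner pairing
  congr 1
  apply setIntegral_congr_fun measurableSet_ball
  intro w _
  ring

/-- **(5-99) at `q = k`**: the lowest-weight vector `Φ_k = 1` has Rühl-norm `1`
(`(2k_R - 1)/π · π/(2k_R - 1) = 1`), for every `k ≥ 2`. -/
theorem ruhlInner_lowest_self (k : ℕ) (hk : 2 ≤ k) : ruhlInner k lowest lowest = 1 := by
  unfold ruhlInner
  rw [pairing_lowest_lowest k hk]
  have hk1 : ((k : ℝ) - 1) ≠ 0 := by
    have : (2 : ℝ) ≤ k := by exact_mod_cast hk
    linarith
  have hk1c : ((k : ℂ) - 1) ≠ 0 := by exact_mod_cast hk1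
  have hπ : (π : ℂ) ≠ 0 := by exact_mod_cast Real.pi_ne_zero
  push_cast
  field_simp

/-- **Unitarity of (5-95)/(5-96)**: `(T_a Φ₁, T_a Φ₂) = (Φ₁, Φ₂)` for every `a ∈ SU(1,1)`, `k ≥ 2`,
and ALL `Φ₁ Φ₂`. -/
theorem ruhlInner_act_act (k : ℕ) (hk : 2 ≤ k) (g : SU11) (Φ₁ Φ₂ : ℂ → ℂ) :
    ruhlInner k (act k g Φ₁) (act k g Φ₂) = ruhlInner k Φ₁ Φ₂ := by
  unfold ruhlInner
  rw [pairing_act_act k hk]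

/-- **Orthogonality of the basis (5-98)**: `(w^{q₁-k}, w^{q₂-k}) = 0` for `q₁ ≠ q₂` (`k ≥ 2`). -/
theorem ruhlInner_monomial_eq_zero (k : ℕ) (hk : 2 ≤ k) {n m : ℕ} (hnm : n ≠ m) :
    ruhlInner k (fun w => w ^ n) (fun w => w ^ m) = 0 := by
  unfold ruhlInner
  rw [pairing_monomial_eq_zero k hk (Ne.symm hnm), mul_zero]

/-- `(Φ, Φ)` is real and non-negative (Rühl's «Hilbert space»). -/
theorem ruhlInner_self_nonneg (k : ℕ) (hk : 2 ≤ k) (Φ : ℂ → ℂ) :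
    0 ≤ (ruhlInner k Φ Φ).re ∧ (ruhlInner k Φ Φ).im = 0 := by
  unfold ruhlInner
  have hk1 : (0 : ℝ) ≤ ((k : ℝ) - 1) / π := by
    have : (2 : ℝ) ≤ k := by exact_mod_cast hk
    have := Real.pi_pos
    apply div_nonneg <;> linarith
  obtain ⟨h1, h2⟩ := pairing_self_nonneg k Φ
  constructor
  · rw [Complex.re_ofReal_mul]
    exact mul_nonneg hk1 h1
  · rw [Complex.im_ofReal_mul, h2, mul_zero]

/-! ### The lowest-weight matrix element -/

/-- **The lowest-weight matrix element in Rühl's normalisation**: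
`(Φ_k, T_a Φ_k) = α^{-2k_R}` for `a = su11 α β` — so `|(Φ_k, T_a Φ_k)| = |α|^{-2k_R} = cosh(η/2)^{-2k_R}`
(`|α| = cosh(η/2)` in the Cartan decomposition); at `2k_R = 3` this is `c_{kk}(η) = cosh(η/2)^{-3}`. -/
theorem ruhlInner_lowest_act (k : ℕ) (hk : 2 ≤ k) (α β : ℂ)
    (h : Complex.normSq α - Complex.normSq β = 1) :
    ruhlInner k lowest (act k (toSU11 α β h) lowest) = α⁻¹ ^ k := by
  unfold ruhlInner
  rw [pairing_act_lowest, pairing_lowest_lowest k hk]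
  have hk1 : ((k : ℝ) - 1) ≠ 0 := by
    have : (2 : ℝ) ≤ k := by exact_mod_cast hk
    linarith
  have hk1c : ((k : ℂ) - 1) ≠ 0 := by exact_mod_cast hk1
  have hπ : (π : ℂ) ≠ 0 := by exact_mod_cast Real.pi_ne_zero
  have hα : mat (toSU11 α β h) 0 0 = α := rfl
  rw [hα]
  push_cast
  field_simp

/-- `|(Φ_k, T_a Φ_k)|² = (1 - |a·0|²)^k` — the printed `cosh(η/2)^{-2k_R}` squared, in the disc picture. -/
theorem norm_ruhlInner_lowest_act_sq (k : ℕ) (hk : 2 ≤ k) (g : SU11) :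
    ‖ruhlInner k lowest (act k g lowest)‖ ^ 2 = (1 - ‖orbit g‖ ^ 2) ^ k := by
  unfold ruhlInner
  rw [pairing_act_lowest, pairing_lowest_lowest k hk]
  have hk1 : ((k : ℝ) - 1) ≠ 0 := by
    have : (2 : ℝ) ≤ k := by exact_mod_cast hk
    linarith
  have hk1c : ((k : ℂ) - 1) ≠ 0 := by exact_mod_cast hk1
  have hπ : (π : ℂ) ≠ 0 := by exact_mod_cast Real.pi_ne_zero
  rw [show ((((k : ℝ) - 1) / π : ℝ) : ℂ) * ((mat g 0 0)⁻¹ ^ k * ((π / ((k : ℝ) - 1) : ℝ) : ℂ)) =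
      (mat g 0 0)⁻¹ ^ k by
        push_cast
        field_simp]
  rw [norm_pow, norm_inv, one_sub_norm_orbit_sq, ← pow_mul, ← pow_mul, mul_comm]

/-! ### The Cartan (bicovariant) form of the matrix element -/

/-- `(Φ_k, T_g Φ_k) = (g₀₀)^{-2k_R}` for every `g ∈ SU(1,1)`. -/
theorem ruhlInner_lowest_act' (k : ℕ) (hk : 2 ≤ k) (g : SU11) :
    ruhlInner k lowest (act k g lowest) = (mat g 0 0)⁻¹ ^ k := by
  unfold ruhlInner
  rw [pairing_act_lowest, pairing_lowest_lowest k hk]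
  have hk1 : ((k : ℝ) - 1) ≠ 0 := by
    have : (2 : ℝ) ≤ k := by exact_mod_cast hk
    linarith
  have hk1c : ((k : ℂ) - 1) ≠ 0 := by exact_mod_cast hk1
  have hπ : (π : ℂ) ≠ 0 := by exact_mod_cast Real.pi_ne_zero
  push_cast
  field_simp

/-- **The printed bicovariant form** (Rühl §6-4: `T^{(k,+)}_{k(ψ₁) a(η) k(ψ₂)}`'s lowest matrix element
is `exp{i(q₁ψ₁ + q₂ψ₂)} · d^J_{kk}(cosh η)` with `d_{kk} = cosh(η/2)^{-2k}`): in the Cartan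
decomposition `g = rot u · a_t · rot v`, `(Φ_k, T_g Φ_k) = (u v)^{-2k_R} · cosh(t)^{-2k_R}`, `η = 2t`. -/
theorem ruhlInner_lowest_act_cartan (k : ℕ) (hk : 2 ≤ k) (u v : Circle) (t : ℝ) :
    ruhlInner k lowest (act k (rot u * hyp t * rot v) lowest) =
      ((u : ℂ) * v)⁻¹ ^ k * ((Real.cosh t : ℂ))⁻¹ ^ k := by
  rw [ruhlInner_lowest_act' k hk, mat_rot_mul_hyp_mul_rot]
  simp only [su11, Matrix.of_apply, Matrix.cons_val', Matrix.cons_val_zero, Matrix.empty_val',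
    Matrix.cons_val_fin_one]
  rw [mul_inv, mul_pow]

/-- **The weight-3 coefficient in the Cartan decomposition**:
`coeff (rot u · a_t · rot v) = (u v)⁻³ · cosh(t)⁻³ · π/2` — S4 l. 82's `‖f‖² cosh(η/2)^{-3}` with the
`K`-phases, `η = 2t`. -/
theorem coeff_cartan (u v : Circle) (t : ℝ) :
    coeff (rot u * hyp t * rot v) =
      ((u : ℂ) * v)⁻¹ ^ 3 * (((Real.cosh t : ℂ))⁻¹ ^ 3 * ((π / 2 : ℝ) : ℂ)) := by
  rw [coeff_rot_mul_rot, coeff_eq, mat_hyp]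
  simp only [su11, Matrix.of_apply, Matrix.cons_val', Matrix.cons_val_zero, Matrix.empty_val',
    Matrix.cons_val_fin_one]

/-- `|coeff (rot u · a_t · rot v)| = (π/2) · cosh(t)^{-3}` — the printed `‖f‖² cosh(η/2)^{-3}`. -/
theorem norm_coeff_cartan' (u v : Circle) (t : ℝ) :
    ‖coeff (rot u * hyp t * rot v)‖ = π / 2 * (Real.cosh t)⁻¹ ^ 3 := by
  rw [coeff_cartan, norm_mul, norm_mul, norm_pow, norm_inv, norm_mul, Circle.norm_coe,
    Circle.norm_coe, one_mul, inv_one, one_pow, one_mul, norm_pow, norm_inv, Complex.norm_real,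
    Real.norm_eq_abs, abs_of_pos (Real.cosh_pos t), Complex.norm_real, Real.norm_eq_abs,
    abs_of_pos (by positivity)]
  ring

/-! ### The formal degree of `(k, +)`: `2k_R - 1 = k - 1` against `μ_R` -/

/-- `|(Φ_k, T_g Φ_k)|² = coeffPow (2k/3) g` — the integrand of `T5SU11CoefficientPow` at `p = 2k/3`. -/
lemma norm_ruhlInner_lowest_act_sq_eq_coeffPow (k : ℕ) (hk : 2 ≤ k) (g : SU11) :
    ‖ruhlInner k lowest (act k g lowest)‖ ^ 2 = T5SU11CoefficientPow.coeffPow (2 * k / 3) g := by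
  rw [norm_ruhlInner_lowest_act_sq k hk, T5SU11CoefficientPow.coeffPow,
    show (3 * (2 * (k : ℝ) / 3) / 2) = ((k : ℕ) : ℝ) by ring, Real.rpow_natCast]

variable [MeasurableSpace Circle] [BorelSpace Circle]

/-- **Schur orthogonality for `(k, +)` against `μ_R`, every `k ≥ 2`**:
`∫_G |(Φ_k, T_g Φ_k)|² dμ_R = 1/(k - 1) = 1/(2k_R - 1)` — with `(Φ_k, Φ_k) = 1`, the formal degree of
Rühl's `(k_R, +)` for the Haar measure `μ_R` is `2k_R - 1` (`= 2` for `π₃⁺`, S4 l. 83). -/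
theorem integral_norm_ruhlInner_lowest_act_sq (k : ℕ) (hk : 2 ≤ k) :
    ∫ g, ‖ruhlInner k lowest (act k g lowest)‖ ^ 2 ∂T5SU11CoefficientL2.ruhl = 1 / ((k : ℝ) - 1) := by
  simp_rw [norm_ruhlInner_lowest_act_sq_eq_coeffPow k hk]
  have hk2 : (2 : ℝ) ≤ k := by exact_mod_cast hk
  rw [T5SU11CoefficientPow.integral_coeffPow_ruhl (2 * k / 3) (by linarith)]
  have hk1 : ((k : ℝ) - 1) ≠ 0 := by linarith
  field_simp

/-- The weight-`3` case: formal degree `2`. -/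
theorem integral_norm_ruhlInner_lowest_act_sq_three :
    ∫ g, ‖ruhlInner 3 lowest (act 3 g lowest)‖ ^ 2 ∂T5SU11CoefficientL2.ruhl = 1 / 2 := by
  rw [integral_norm_ruhlInner_lowest_act_sq 3 (by norm_num)]
  norm_num

end Summit.Ventures.HodgeRepro2.T5BergmanRuhlModel
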